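import Literature.Analysis.FluidPDE.LerayHopfMildForced
import Literature.Analysis.FluidPDE.LerayHopfMildH1
import HarnessLib

/-!
# The duality identity WITH force against `H¹_σ` fields

Analysis/FluidPDE support file: the **forced twin** of the main theorem of
`Literature/Analysis/FluidPDE/LerayHopfMildH1.lean`
(`IsLerayHopfOn.integral_inner_eq_mild_of_hasWeakGradient`, which hard-codes `f = 0`). It serves
PATH A of the discharge of Tao's forced unconditional uniqueness theorem
`Literature.Analysis.FluidPDE.tao2011_forced_unconditionalUniqueness_velocity` (Tao 2011,
Cor. 11.4): the forced bounded-total-speed estimate (Tao 2011, Prop. 9.1) tests the forced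
Duhamel formula (9.2) against the Leray-projected heat kernel `P(G_σ(· - x₀)e)`, an `H¹_σ`
field that is not compactly supported.

**Main result** (proved). Let `E` be a finite-dimensional real inner product space with
`dim E = 3`, `0 < ν`, `0 < T`, `u₀ ∈ L²`, `f ∈ L²((0,T) × E; E)` jointly a.e.-strongly
measurable, `u` a Leray–Hopf weak solution of the forced Navier–Stokes system on `E × [0, T)`
with datum `u₀`, force `f` and `sup_{[0,T]} ‖u(s)‖₂ ≤ M < ∞`, and `φ ∈ L²(E; E)` weakly
divergence free with a weak gradient `G`, `∫|G|² < ∞` (`φ ∈ H¹_σ`). Then for every `t ∈ (0, T]`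

* `IsLerayHopfOn.integral_inner_eq_mild_of_hasWeakGradient_forced`:
  `⟨u(t), φ⟩ = ⟨u₀, e^{νtΔ}φ⟩ + ∫_{(0,t]} ⟨u(τ), (u(τ)·∇) e^{ν(t-τ)Δ}φ⟩ dτ
      + ∫_{(0,t]} ⟨f(τ), e^{ν(t-τ)Δ}φ⟩ dτ`
  (Fabes–Jones–Rivière 1972, Thm. 2.1; Lemarié-Rieusset 2016, Prop. 6.5; Tao 2011, (9.2)).

## Proof

Verbatim the approximation argument of `LerayHopfMildH1` — divergence-free test fields
`Φₙ → φ` in `H¹` (`exists_isDivFree_test_approx`), the forced identity for compactly supported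
tests (`IsLerayHopfOn.integral_inner_eq_mild_forced`, `LerayHopfMildForced`), and passage to the
limit in the two linear terms and the nonlinear term exactly as there — plus the force term:
for a.e. `τ ∈ (0,t)` the slice `f(τ)` is in `L²` (Tonelli) and
`|⟨f(τ), e^{ν(t-τ)Δ}(Φₙ - φ)⟩| ≤ ‖f(τ)‖₂ ‖Φₙ - φ‖₂` (`L²` contraction of the heat flow), which
is summable against `∫₀ᵀ ‖f(τ)‖₂ dτ < ∞` (`lintegral_eLpNorm_two_slice_lt_top_of_eLpNorm_prod`);
the limit pairing `τ ↦ ⟨f(τ), e^{ν(t-τ)Δ}φ⟩` is measurable as an a.e. limit and dominated by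
`‖f(τ)‖₂‖φ‖₂`.

## References

* E. B. Fabes, B. F. Jones, N. M. Rivière, *The initial value problem for the Navier–Stokes
  equations with data in `L^p`*, Arch. Rational Mech. Anal. 45 (1972) 222–240, Thm. 2.1
  (`FabesJonesRiviere1972`).
* P. G. Lemarié-Rieusset, *The Navier–Stokes Problem in the 21st Century*, CRC Press (2016),
  Prop. 6.5, Thm. 6.1 (`LemarieRieusset2016`).
* T. Tao, *Localisation and compactness properties of the Navier–Stokes global regularity
  problem*, Anal. PDE 6 (2013) 25–107, arXiv:1108.1165, §9, (9.2) (`Tao2011`).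
-/

noncomputable section

open MeasureTheory TopologicalSpace Set Function Filter Topology InnerProductSpace
open scoped RealInnerProductSpace ENNReal NNReal ContDiff

namespace Literature.Analysis.FluidPDE

open UnboundedOperators

variable {E : Type*} [NormedAddCommGroup E] [InnerProductSpace ℝ E] [FiniteDimensional ℝ E]
  [MeasurableSpace E] [BorelSpace E]

section MainForced

variable {T ν : ℝ} {f : ℝ → E → E} {u₀ : E → E} {u : ℝ → E → E}

/-- **Leray–Hopf weak solutions of the FORCED system satisfy the duality (mild) identity against
every `H¹_σ` field.** Let `dim E = 3`, `0 < ν`, `u₀ ∈ L²`, `f ∈ L²((0,T) × E)` jointly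
a.e.-strongly measurable, `u` a Leray–Hopf weak solution of the forced Navier–Stokes system on
`E × [0, T)` with datum `u₀`, force `f` and `sup_{s ∈ [0,T]} ‖u(s)‖₂ ≤ M < ∞`, and
`φ ∈ L²(E; E)` weakly divergence free with a weak gradient `G`, `∫ |G|² < ∞`. Then for every
`t ∈ (0, T]`,
`⟨u(t), φ⟩ = ⟨u₀, e^{νtΔ}φ⟩ + ∫_{(0,t]} ⟨u(τ), (u(τ)·∇) e^{ν(t-τ)Δ}φ⟩ dτ + ∫_{(0,t]} ⟨f(τ), e^{ν(t-τ)Δ}φ⟩ dτ`.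
[cite: FabesJonesRiviere1972, Thm. 2.1; Tao2011, §9 (9.2)] -/
theorem IsLerayHopfOn.integral_inner_eq_mild_of_hasWeakGradient_forced
    (hE3 : Module.finrank ℝ E = 3)
    (hu : IsLerayHopfOn T ν f u₀ u) (hu₀ : MemLp u₀ 2 volume) (hν : 0 < ν) (hT : 0 < T)
    (hfm : AEStronglyMeasurable (uncurry f) ((volume.restrict (Ioo 0 T)).prod (volume : Measure E)))
    (hf2 : eLpNorm (uncurry f) 2 ((volume.restrict (Ioo 0 T)).prod (volume : Measure E)) < ⊤)
    {M : ℝ≥0∞} (hMtop : M ≠ ⊤) (hM : ∀ s ∈ Icc 0 T, eLpNorm (u s) 2 volume ≤ M)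
    {φ : E → E} {Gφ : E → E →L[ℝ] E} (hφ2 : MemLp φ 2 volume) (hdiv : IsWeaklyDivFree φ)
    (hφG : HasWeakGradient φ Gφ) (hG2 : ∫⁻ x, ENNReal.ofReal (frobeniusNormSq (Gφ x)) < ⊤)
    {t : ℝ} (ht : t ∈ Ioc 0 T) :
    ∫ x, ⟪u t x, φ x⟫ = (∫ x, ⟪u₀ x, heatTest ν φ t x⟫) +
      (∫ τ in Ioc 0 t, ∫ x, ⟪u τ x, convect (u τ) (heatTest ν φ (t - τ)) x⟫) +
      ∫ τ in Ioc 0 t, ∫ x, ⟪f τ x, heatTest ν φ (t - τ) x⟫ := by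
  haveI : ENNReal.HolderTriple 4 4 2 := holderTriple_four_four_two
  have htT : t ≤ T := ht.2
  have ht0 : 0 < t := ht.1
  have hL2 : ∀ s ∈ Icc 0 T, MemLp (u s) 2 volume := hu.memLp
  -- ### the approximating divergence-free test fields
  set δ : ℕ → ℝ≥0∞ := fun n => ENNReal.ofReal (1 / ((n : ℝ) + 1)) with hδ
  have hδpos : ∀ n, 0 < δ n := fun n => ENNReal.ofReal_pos.2 (by positivity)
  have hδ0 : Tendsto δ atTop (𝓝 0) := by
    have h := ENNReal.tendsto_ofReal (tendsto_one_div_add_atTop_nhds_zero_nat)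
    rwa [ENNReal.ofReal_zero] at h
  have hex : ∀ n : ℕ, ∃ Φ : E → E, FunctionSpaces.IsTestFunctionOn (⊤ : Opens E) Φ ∧
      VectorCalculus.IsDivFree Φ ∧ eLpNorm (Φ - φ) 2 volume ≤ δ n ∧
      ∫⁻ x, ENNReal.ofReal (frobeniusNormSq (fderiv ℝ Φ x - Gφ x)) ≤ δ n := fun n =>
    exists_isDivFree_test_approx hE3 hφ2 hdiv hφG hG2 (hδpos n)
  choose Φ hΦt hΦdiv hΦL2 hΦD using hex
  have hΦ2 : ∀ n, MemLp (Φ n) 2 volume := fun n => (hΦt n).memLp_volume 2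
  -- the identity for each `Φ n`, with the time integral over `Ioo 0 t`
  set c : ℕ → ℝ → ℝ := fun n τ =>
    ∫ x, ⟪u τ x, convect (u τ) (heatTest ν (Φ n) (t - τ)) x⟫ with hc
  set cφ : ℝ → ℝ := fun τ => ∫ x, ⟪u τ x, convect (u τ) (heatTest ν φ (t - τ)) x⟫ with hcφ
  set d : ℕ → ℝ → ℝ := fun n τ => ∫ x, ⟪f τ x, heatTest ν (Φ n) (t - τ) x⟫ with hd
  set dφ : ℝ → ℝ := fun τ => ∫ x, ⟪f τ x, heatTest ν φ (t - τ) x⟫ with hdφ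
  have hI : ∀ n, ∫ x, ⟪u t x, Φ n x⟫ = (∫ x, ⟪u₀ x, heatTest ν (Φ n) t x⟫) +
      (∫ τ in Ioo 0 t, c n τ) + ∫ τ in Ioo 0 t, d n τ := fun n => by
    rw [← integral_Ioc_eq_integral_Ioo, ← integral_Ioc_eq_integral_Ioo]
    exact hu.integral_inner_eq_mild_forced hE3 hu₀ hν hT hfm hf2 hMtop hM (hΦt n) (hΦdiv n) ht
  -- the slab `(0, t)` and the force slices
  set μt : Measure ℝ := volume.restrict (Ioo 0 t) with hμt
  have hsubT : Ioo 0 t ⊆ Ioo 0 T := Ioo_subset_Ioo le_rfl htT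
  have hμle : μt ≤ volume.restrict (Ioo 0 T) := Measure.restrict_mono hsubT le_rfl
  have hmemt : ∀ᵐ τ ∂μt, τ ∈ Ioo 0 t := ae_restrict_mem measurableSet_Ioo
  have hIf : ∫⁻ τ, eLpNorm (f τ) 2 volume ∂μt < ⊤ :=
    lt_of_le_of_lt (lintegral_mono' hμle le_rfl)
      (lintegral_eLpNorm_two_slice_lt_top_of_eLpNorm_prod hfm hf2)
  have hfsl : ∀ᵐ τ ∂μt, MemLp (f τ) 2 volume :=
    ae_mono hμle (ae_memLp_two_slice_of_eLpNorm_prod hfm hf2)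
  have hF2m : AEMeasurable (fun s => eLpNorm (f s) 2 volume) μt := by
    have hm : AEMeasurable (fun s => (∫⁻ x, ‖f s x‖ₑ ^ (2 : ℝ) ∂volume) ^ (1 / 2 : ℝ))
        (volume.restrict (Ioo 0 T)) :=
      ((hfm.enorm.pow_const _).lintegral_prod_right').pow_const _
    refine (hm.mono_measure hμle).congr (ae_of_all _ fun s => ?_)
    simp only
    rw [eLpNorm_eq_lintegral_rpow_enorm_toReal two_ne_zero ENNReal.ofNat_ne_top, ENNReal.toReal_ofNat]
  -- ### (a) the pairing at time `t`
  have hlimL : Tendsto (fun n => ∫ x, ⟪u t x, Φ n x⟫) atTop (𝓝 (∫ x, ⟪u t x, φ x⟫)) := by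
    have hut : MemLp (u t) 2 volume := hL2 t ⟨ht0.le, htT⟩
    refine tendsto_of_enorm_sub_le (e := fun n => eLpNorm (u t) 2 volume * δ n) (fun n => ?_) ?_
    · have hsub : (∫ x, ⟪u t x, Φ n x⟫) - ∫ x, ⟪u t x, φ x⟫ = ∫ x, ⟪u t x, Φ n x - φ x⟫ := by
        rw [← integral_sub (FunctionSpaces.integrable_inner_of_eLpNorm_two_lt_top hut.1 (hΦ2 n).1
          hut.2 (hΦ2 n).2) (FunctionSpaces.integrable_inner_of_eLpNorm_two_lt_top hut.1 hφ2.1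
          hut.2 hφ2.2)]
        exact integral_congr_ae (Eventually.of_forall fun x => (inner_sub_right _ _ _).symm)
      rw [hsub]
      exact (FunctionSpaces.enorm_integral_inner_le_eLpNorm_mul hut.1 ((hΦ2 n).1.sub hφ2.1)).trans
        (mul_le_mul' le_rfl (hΦL2 n))
    · have h := ENNReal.Tendsto.const_mul hδ0 (Or.inr hut.eLpNorm_ne_top)
      rwa [mul_zero] at h
  -- ### (b) the free term
  have hlimA : Tendsto (fun n => ∫ x, ⟪u₀ x, heatTest ν (Φ n) t x⟫) atTop
      (𝓝 (∫ x, ⟪u₀ x, heatTest ν φ t x⟫)) := by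
    have hνt : 0 < ν * t := mul_pos hν ht0
    have hH : ∀ {f : E → E}, MemLp f 2 volume → MemLp (heatTest ν f t) 2 volume := fun hf => by
      rw [heatTest_of_pos hν ht0]
      exact memLp_heatExtension_holds hf one_le_two hνt
    refine tendsto_of_enorm_sub_le (e := fun n => eLpNorm u₀ 2 volume * δ n) (fun n => ?_) ?_
    · have hsub : (∫ x, ⟪u₀ x, heatTest ν (Φ n) t x⟫) - ∫ x, ⟪u₀ x, heatTest ν φ t x⟫ =
          ∫ x, ⟪u₀ x, heatTest ν (Φ n - φ) t x⟫ := by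
        rw [← integral_sub (FunctionSpaces.integrable_inner_of_eLpNorm_two_lt_top hu₀.1 (hH (hΦ2 n)).1
          hu₀.2 (hH (hΦ2 n)).2) (FunctionSpaces.integrable_inner_of_eLpNorm_two_lt_top hu₀.1
          (hH hφ2).1 hu₀.2 (hH hφ2).2)]
        refine integral_congr_ae (Eventually.of_forall fun x => ?_)
        dsimp only
        rw [← inner_sub_right, heatTest_of_pos hν ht0, heatTest_of_pos hν ht0, heatTest_of_pos hν ht0,
          heatExtension_sub_of_memLp (hΦ2 n) hφ2 one_le_two hνt]
      rw [hsub]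
      refine (FunctionSpaces.enorm_integral_inner_le_eLpNorm_mul hu₀.1 (hH ((hΦ2 n).sub hφ2)).1).trans ?_
      refine mul_le_mul' le_rfl (le_trans ?_ (hΦL2 n))
      rw [heatTest_of_pos hν ht0]
      exact eLpNorm_heatExtension_le_holds ((hΦ2 n).sub hφ2) one_le_two hνt
    · have h := ENNReal.Tendsto.const_mul hδ0 (Or.inr hu₀.eLpNorm_ne_top)
      rwa [mul_zero] at h
  -- ### (c) the nonlinear term
  have hlimC : Tendsto (fun n => ∫ τ in Ioo 0 t, c n τ) atTop (𝓝 (∫ τ in Ioo 0 t, cφ τ)) := by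
    -- a jointly measurable weak-gradient witness, for the `L⁴` integrability of the slices
    obtain ⟨G, hG, hG₂, -, -⟩ := hu.weakGrad_energy
    obtain ⟨Gu, hGum, hGuae⟩ := exists_stronglyMeasurable_weakGradient hu.weak.1 hG
    have hGu : ∀ᵐ τ ∂(volume.restrict (Ioo 0 T)), HasWeakGradient (u τ) (Gu τ) := by
      filter_upwards [hG, hGuae] with τ h1 h2
      exact h1.congr_grad_ae h2
    have hGu₂ : ∫⁻ τ in Ioo 0 T, ∫⁻ x, ENNReal.ofReal (frobeniusNormSq (Gu τ x)) < ⊤ := by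
      have hDeq : ∀ᵐ τ ∂(volume.restrict (Ioo 0 T)),
          ∫⁻ x, ENNReal.ofReal (frobeniusNormSq (Gu τ x)) =
            ∫⁻ x, ENNReal.ofReal (frobeniusNormSq (G τ x)) := by
        filter_upwards [hGuae] with τ hτ
        exact lintegral_congr_ae (by filter_upwards [hτ] with x hx; rw [hx])
      rw [lintegral_congr_ae hDeq]; exact hG₂
    -- the weight `W τ = ‖u τ‖₄²`, integrable on `(0, T)`
    set W : ℝ → ℝ≥0∞ := fun τ => eLpNorm (u τ) 4 volume ^ (2 : ℝ) with hW
    have hIW : ∫⁻ τ in Ioo 0 T, W τ < ⊤ := hu.lintegral_eLpNorm_four_sq_lt_top hE3 hGum hGu hGu₂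
    have hWm : AEMeasurable W (volume.restrict (Ioo 0 T)) :=
      (FunctionSpaces.aemeasurable_eLpNorm_slice hu.aestronglyMeasurable_uncurry 4).pow_const _
    have hIWt : ∫⁻ τ, W τ ∂μt < ⊤ := lt_of_le_of_lt (lintegral_mono' hμle le_rfl) hIW
    have hWmt : AEMeasurable W μt := hWm.mono_measure hμle
    have hWfin : ∀ᵐ τ ∂μt, W τ < ⊤ := ae_lt_top' hWmt hIWt.ne
    -- the caloric gradient fields
    set A : ℕ → ℝ → E → E →L[ℝ] E := fun n τ x => fderiv ℝ (heatTest ν (Φ n) (t - τ)) x with hA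
    set Aφ : ℝ → E → E →L[ℝ] E := fun τ x => fderiv ℝ (heatTest ν φ (t - τ)) x with hAφ
    have hAc : ∀ n, Continuous fun q : ℝ × E => A n q.1 q.2 := fun n =>
      (continuous_uncurry_fderiv_heatTest (hΦt n) ν).comp
        ((continuous_const.sub continuous_fst).prodMk continuous_snd)
    have hAeq : ∀ n τ, τ < t → A n τ = fun x => fderiv ℝ (heatExtension (Φ n) (ν * (t - τ))) x :=
      fun n τ hτ => funext fun x => by simp only [hA, heatTest_of_pos hν (sub_pos.2 hτ)]
    have hAφeq : ∀ τ, τ < t → Aφ τ = fun x => fderiv ℝ (heatExtension φ (ν * (t - τ))) x :=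
      fun τ hτ => funext fun x => by simp only [hAφ, heatTest_of_pos hν (sub_pos.2 hτ)]
    have hAφm : ∀ τ, τ < t → AEStronglyMeasurable (Aφ τ) volume := fun τ hτ => by
      rw [hAφeq τ hτ]
      exact (continuous_fderiv_heatExtension_of_memLp hφ2 one_le_two
        (mul_pos hν (sub_pos.2 hτ))).aestronglyMeasurable
    -- Frobenius bounds: `∫|Aφ|² ≤ ∫|Gφ|²` and `∫|A n - Aφ|² ≤ δ n`
    have hAφD : ∀ τ, τ < t → ∫⁻ x, ENNReal.ofReal (frobeniusNormSq (Aφ τ x)) ≤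
        ∫⁻ x, ENNReal.ofReal (frobeniusNormSq (Gφ x)) := by
      intro τ hτ
      have h := lintegral_frobeniusNormSq_fderiv_heatExtension_sub_le
        (FunctionSpaces.isTestFunctionOn_zero (⊤ : Opens E)) hφG hφ2 hG2 (mul_pos hν (sub_pos.2 hτ))
      have h0 : ∀ r : ℝ, heatExtension (0 : E → E) r = 0 := fun r => by
        funext x; simp [heatExtension_apply]
      simp only [h0, fderiv_zero, Pi.zero_apply, zero_sub] at h
      have hneg : ∀ L : E →L[ℝ] E, frobeniusNormSq (-L) = frobeniusNormSq L := fun L => by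
        rw [← zero_sub, frobeniusNormSq_sub_comm, sub_zero]
      rw [hAφeq τ hτ]
      simpa only [hneg] using h
    have hAD : ∀ n τ, τ < t → ∫⁻ x, ENNReal.ofReal (frobeniusNormSq (A n τ x - Aφ τ x)) ≤ δ n := by
      intro n τ hτ
      rw [hAeq n τ hτ, hAφeq τ hτ]
      exact (lintegral_frobeniusNormSq_fderiv_heatExtension_sub_le (hΦt n) hφG hφ2 hG2
        (mul_pos hν (sub_pos.2 hτ))).trans (hΦD n)
    -- measurability of `c n` on `(0, t)`
    have hum : AEStronglyMeasurable (uncurry u) (μt.prod volume) :=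
      hu.aestronglyMeasurable_uncurry.mono_measure (Measure.prod_mono hμle le_rfl)
    have hcm : ∀ n, AEStronglyMeasurable (c n) μt := by
      intro n
      have hm : AEStronglyMeasurable
          (fun q : ℝ × E => ⟪uncurry u q, A n q.1 q.2 (uncurry u q)⟫) (μt.prod volume) :=
        hum.inner (isBoundedBilinearMap_apply.continuous.comp_aestronglyMeasurable
          ((hAc n).aestronglyMeasurable.prodMk hum))
      exact hm.integral_prod_right'
    -- pointwise bounds at good times
    set CG : ℝ≥0∞ := (∫⁻ x, ENNReal.ofReal (frobeniusNormSq (Gφ x))) ^ (1 / 2 : ℝ) with hCG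
    have hCGtop : CG ≠ ⊤ := ENNReal.rpow_ne_top_of_nonneg (by norm_num) hG2.ne
    have hgood : ∀ᵐ τ ∂μt, (∀ n, ‖c n τ - cφ τ‖ₑ ≤ δ n ^ (1 / 2 : ℝ) * W τ) ∧
        ‖cφ τ‖ₑ ≤ CG * W τ ∧ W τ < ⊤ := by
      filter_upwards [hWfin, hmemt] with τ hWτ hτ
      have h4τ : eLpNorm (u τ) 4 volume < ⊤ := by
        have : eLpNorm (u τ) 4 volume ^ (2 : ℝ) < ⊤ := hWτ
        exact (ENNReal.rpow_lt_top_iff_of_pos zero_lt_two).1 this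
      have hmem4 : MemLp (u τ) 4 volume := ⟨(hL2 τ ⟨hτ.1.le, hτ.2.le.trans htT⟩).1, h4τ⟩
      have hWeq : W τ = eLpNorm (u τ) 4 volume * eLpNorm (u τ) 4 volume := by
        simp only [hW]
        rw [ENNReal.rpow_two, sq]
      have hAφ2 : ∫⁻ x, ENNReal.ofReal (frobeniusNormSq (Aφ τ x)) < ⊤ :=
        (hAφD τ hτ.2).trans_lt hG2
      have hA12 : ∀ n, ∫⁻ x, ENNReal.ofReal (frobeniusNormSq (A n τ x - Aφ τ x)) < ⊤ := fun n =>
        (hAD n τ hτ.2).trans_lt ENNReal.ofReal_lt_top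
      have hAnm : ∀ n, AEStronglyMeasurable (A n τ) volume := fun n =>
        ((hAc n).comp (Continuous.prodMk_right τ)).aestronglyMeasurable
      have hA12m : ∀ n, AEStronglyMeasurable (fun x => A n τ x - Aφ τ x) volume := fun n =>
        (hAnm n).sub (hAφm τ hτ.2)
      -- integrability of the two pieces of `c n τ`
      have iφ : Integrable (fun x => ⟪u τ x, Aφ τ x (u τ x)⟫) :=
        (integrable_inner_apply_of_holder (hAφm τ hτ.2) hAφ2 hmem4 hmem4).congr
          (ae_of_all _ fun x => real_inner_comm _ _)
      have i12 : ∀ n, Integrable (fun x => ⟪u τ x, (A n τ x - Aφ τ x) (u τ x)⟫) := fun n =>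
        (integrable_inner_apply_of_holder (hA12m n) (hA12 n) hmem4 hmem4).congr
          (ae_of_all _ fun x => real_inner_comm _ _)
      have hcn : ∀ n, c n τ - cφ τ = ∫ x, ⟪u τ x, (A n τ x - Aφ τ x) (u τ x)⟫ := by
        intro n
        have h1 : c n τ = (∫ x, ⟪u τ x, (A n τ x - Aφ τ x) (u τ x)⟫) + cφ τ := by
          simp only [hc, hcφ, convect_apply]
          rw [← integral_add (i12 n) iφ]
          refine integral_congr_ae (ae_of_all _ fun x => ?_)
          dsimp only
          rw [← inner_add_right, sub_apply, sub_add_cancel]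
        rw [h1, add_sub_cancel_right]
      refine ⟨fun n => ?_, ?_, hWτ⟩
      · rw [hcn n]
        refine (enorm_integral_le_lintegral_enorm _).trans ?_
        calc ∫⁻ x, ‖⟪u τ x, (A n τ x - Aφ τ x) (u τ x)⟫‖ₑ
            = ∫⁻ x, ‖⟪(A n τ x - Aφ τ x) (u τ x), u τ x⟫‖ₑ :=
              lintegral_congr fun x => by rw [real_inner_comm]
          _ ≤ (∫⁻ x, ENNReal.ofReal (frobeniusNormSq (A n τ x - Aφ τ x))) ^ (1 / 2 : ℝ) *
                (eLpNorm (u τ) 4 volume * eLpNorm (u τ) 4 volume) :=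
              lintegral_enorm_inner_apply_le (hA12m n) hmem4.1 hmem4.1 4 4
          _ ≤ δ n ^ (1 / 2 : ℝ) * W τ := by
              rw [hWeq]
              gcongr
              exact hAD n τ hτ.2
      · simp only [hcφ, convect_apply]
        refine (enorm_integral_le_lintegral_enorm _).trans ?_
        calc ∫⁻ x, ‖⟪u τ x, Aφ τ x (u τ x)⟫‖ₑ
            = ∫⁻ x, ‖⟪Aφ τ x (u τ x), u τ x⟫‖ₑ := lintegral_congr fun x => by rw [real_inner_comm]
          _ ≤ (∫⁻ x, ENNReal.ofReal (frobeniusNormSq (Aφ τ x))) ^ (1 / 2 : ℝ) *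
                (eLpNorm (u τ) 4 volume * eLpNorm (u τ) 4 volume) :=
              lintegral_enorm_inner_apply_le (hAφm τ hτ.2) hmem4.1 hmem4.1 4 4
          _ ≤ CG * W τ := by
              rw [hWeq, hCG]
              exact mul_le_mul' (ENNReal.rpow_le_rpow (hAφD τ hτ.2) (by norm_num)) le_rfl
    -- pointwise convergence, measurability and integrability of the limit
    have hδhalf : Tendsto (fun n => δ n ^ (1 / 2 : ℝ)) atTop (𝓝 0) := by
      have h := hδ0.ennrpow_const (1 / 2 : ℝ)
      rwa [ENNReal.zero_rpow_of_pos (by norm_num)] at h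
    have hptw : ∀ᵐ τ ∂μt, Tendsto (fun n => c n τ) atTop (𝓝 (cφ τ)) := by
      filter_upwards [hgood] with τ hτ
      refine tendsto_of_enorm_sub_le (e := fun n => δ n ^ (1 / 2 : ℝ) * W τ) hτ.1 ?_
      have h := ENNReal.Tendsto.mul_const hδhalf (Or.inr hτ.2.2.ne)
      rwa [zero_mul] at h
    have hcφm : AEStronglyMeasurable cφ μt := aestronglyMeasurable_of_tendsto_ae atTop hcm hptw
    have hcφi : Integrable cφ μt := by
      refine ⟨hcφm, ?_⟩
      calc ∫⁻ τ, ‖cφ τ‖ₑ ∂μt ≤ ∫⁻ τ, CG * W τ ∂μt :=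
            lintegral_mono_ae (hgood.mono fun τ hτ => hτ.2.1)
        _ = CG * ∫⁻ τ, W τ ∂μt := lintegral_const_mul'' _ hWmt
        _ < ⊤ := ENNReal.mul_lt_top hCGtop.lt_top hIWt
    have hci : ∀ n, Integrable (c n) μt := by
      intro n
      refine ⟨hcm n, ?_⟩
      have hle : ∀ᵐ τ ∂μt, ‖c n τ‖ₑ ≤ (δ n ^ (1 / 2 : ℝ) + CG) * W τ := by
        filter_upwards [hgood] with τ hτ
        calc ‖c n τ‖ₑ = ‖(c n τ - cφ τ) + cφ τ‖ₑ := by rw [sub_add_cancel]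
          _ ≤ ‖c n τ - cφ τ‖ₑ + ‖cφ τ‖ₑ := enorm_add_le _ _
          _ ≤ δ n ^ (1 / 2 : ℝ) * W τ + CG * W τ := add_le_add (hτ.1 n) hτ.2.1
          _ = (δ n ^ (1 / 2 : ℝ) + CG) * W τ := by rw [add_mul]
      calc ∫⁻ τ, ‖c n τ‖ₑ ∂μt ≤ ∫⁻ τ, (δ n ^ (1 / 2 : ℝ) + CG) * W τ ∂μt := lintegral_mono_ae hle
        _ = (δ n ^ (1 / 2 : ℝ) + CG) * ∫⁻ τ, W τ ∂μt := lintegral_const_mul'' _ hWmt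
        _ < ⊤ := ENNReal.mul_lt_top (ENNReal.add_lt_top.2
            ⟨ENNReal.rpow_lt_top_of_nonneg (by norm_num) ENNReal.ofReal_ne_top, hCGtop.lt_top⟩) hIWt
    -- convergence of the time integrals
    refine tendsto_of_enorm_sub_le (e := fun n => δ n ^ (1 / 2 : ℝ) * ∫⁻ τ, W τ ∂μt)
      (fun n => ?_) ?_
    · rw [← integral_sub (hci n) hcφi]
      refine (enorm_integral_le_lintegral_enorm _).trans ?_
      calc ∫⁻ τ, ‖c n τ - cφ τ‖ₑ ∂μt ≤ ∫⁻ τ, δ n ^ (1 / 2 : ℝ) * W τ ∂μt :=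
            lintegral_mono_ae (hgood.mono fun τ hτ => hτ.1 n)
        _ = δ n ^ (1 / 2 : ℝ) * ∫⁻ τ, W τ ∂μt := lintegral_const_mul'' _ hWmt
    · have h := ENNReal.Tendsto.mul_const hδhalf (Or.inr hIWt.ne)
      rwa [zero_mul] at h
  -- ### (d) the force term
  have hlimD : Tendsto (fun n => ∫ τ in Ioo 0 t, d n τ) atTop (𝓝 (∫ τ in Ioo 0 t, dφ τ)) := by
    have hH : ∀ {g : E → E}, MemLp g 2 volume → ∀ τ, τ < t →
        MemLp (heatTest ν g (t - τ)) 2 volume ∧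
          eLpNorm (heatTest ν g (t - τ)) 2 volume ≤ eLpNorm g 2 volume := fun hg τ hτ => by
      have hνs : 0 < ν * (t - τ) := mul_pos hν (sub_pos.2 hτ)
      rw [heatTest_of_pos hν (sub_pos.2 hτ)]
      exact ⟨memLp_heatExtension_holds hg one_le_two hνs,
        eLpNorm_heatExtension_le_holds hg one_le_two hνs⟩
    -- pointwise bounds at the times where `f(τ) ∈ L²`
    have hgood : ∀ᵐ τ ∂μt, (∀ n, ‖d n τ - dφ τ‖ₑ ≤ eLpNorm (f τ) 2 volume * δ n) ∧
        ‖dφ τ‖ₑ ≤ eLpNorm (f τ) 2 volume * eLpNorm φ 2 volume ∧ eLpNorm (f τ) 2 volume < ⊤ := by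
      filter_upwards [hfsl, hmemt] with τ hfτ hτ
      obtain ⟨hφH, hφHle⟩ := hH hφ2 τ hτ.2
      refine ⟨fun n => ?_, ?_, hfτ.eLpNorm_lt_top⟩
      · obtain ⟨hΦH, -⟩ := hH (hΦ2 n) τ hτ.2
        obtain ⟨hdH, hdHle⟩ := hH ((hΦ2 n).sub hφ2) τ hτ.2
        have hsub : d n τ - dφ τ = ∫ x, ⟪f τ x, heatTest ν (Φ n - φ) (t - τ) x⟫ := by
          simp only [hd, hdφ]
          rw [← integral_sub (FunctionSpaces.integrable_inner_of_eLpNorm_two_lt_top hfτ.1 hΦH.1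
            hfτ.2 hΦH.2) (FunctionSpaces.integrable_inner_of_eLpNorm_two_lt_top hfτ.1 hφH.1
            hfτ.2 hφH.2)]
          refine integral_congr_ae (Eventually.of_forall fun x => ?_)
          dsimp only
          rw [← inner_sub_right, heatTest_of_pos hν (sub_pos.2 hτ.2),
            heatTest_of_pos hν (sub_pos.2 hτ.2), heatTest_of_pos hν (sub_pos.2 hτ.2),
            heatExtension_sub_of_memLp (hΦ2 n) hφ2 one_le_two (mul_pos hν (sub_pos.2 hτ.2))]
        rw [hsub]
        exact (FunctionSpaces.enorm_integral_inner_le_eLpNorm_mul hfτ.1 hdH.1).trans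
          (mul_le_mul' le_rfl (hdHle.trans (hΦL2 n)))
      · simp only [hdφ]
        exact (FunctionSpaces.enorm_integral_inner_le_eLpNorm_mul hfτ.1 hφH.1).trans
          (mul_le_mul' le_rfl hφHle)
    -- measurability of `d n` (joint continuity of the caloric test field) and of the limit
    have hdm : ∀ n, AEStronglyMeasurable (d n) μt := by
      intro n
      obtain ⟨CΦ, hCΦ⟩ :=
        (hΦt n).contDiff.continuous.bounded_above_of_compact_support (hΦt n).hasCompactSupport
      have hψc : Continuous fun q : ℝ × E => heatTest ν (Φ n) (t - q.1) q.2 := by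
        have h1 : Continuous fun q : ℝ × E => heatFlow (Φ n) (ν * (t - q.1)) q.2 :=
          (continuous_uncurry_heatFlow (hΦt n).contDiff.continuous hCΦ).comp
            ((continuous_const.mul (continuous_const.sub continuous_fst)).prodMk continuous_snd)
        exact h1
      have h1 : AEStronglyMeasurable (fun q : ℝ × E => ⟪uncurry f q, heatTest ν (Φ n) (t - q.1) q.2⟫)
          (((volume : Measure ℝ).restrict (Ioo 0 T)).prod (volume : Measure E)) :=
        hfm.inner hψc.aestronglyMeasurable
      exact (h1.integral_prod_right').mono_measure hμle
    have hptw : ∀ᵐ τ ∂μt, Tendsto (fun n => d n τ) atTop (𝓝 (dφ τ)) := by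
      filter_upwards [hgood] with τ hτ
      refine tendsto_of_enorm_sub_le (e := fun n => eLpNorm (f τ) 2 volume * δ n) hτ.1 ?_
      have h := ENNReal.Tendsto.const_mul hδ0 (Or.inr hτ.2.2.ne)
      rwa [mul_zero] at h
    have hdφm : AEStronglyMeasurable dφ μt := aestronglyMeasurable_of_tendsto_ae atTop hdm hptw
    have hdφi : Integrable dφ μt := by
      refine ⟨hdφm, ?_⟩
      calc ∫⁻ τ, ‖dφ τ‖ₑ ∂μt ≤ ∫⁻ τ, eLpNorm (f τ) 2 volume * eLpNorm φ 2 volume ∂μt :=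
            lintegral_mono_ae (hgood.mono fun τ hτ => hτ.2.1)
        _ = (∫⁻ τ, eLpNorm (f τ) 2 volume ∂μt) * eLpNorm φ 2 volume :=
            lintegral_mul_const'' _ hF2m
        _ < ⊤ := ENNReal.mul_lt_top hIf hφ2.eLpNorm_lt_top
    have hdi : ∀ n, Integrable (d n) μt := by
      intro n
      refine ⟨hdm n, ?_⟩
      have hle : ∀ᵐ τ ∂μt, ‖d n τ‖ₑ ≤ eLpNorm (f τ) 2 volume * (δ n + eLpNorm φ 2 volume) := by
        filter_upwards [hgood] with τ hτ
        calc ‖d n τ‖ₑ = ‖(d n τ - dφ τ) + dφ τ‖ₑ := by rw [sub_add_cancel]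
          _ ≤ ‖d n τ - dφ τ‖ₑ + ‖dφ τ‖ₑ := enorm_add_le _ _
          _ ≤ eLpNorm (f τ) 2 volume * δ n + eLpNorm (f τ) 2 volume * eLpNorm φ 2 volume :=
              add_le_add (hτ.1 n) hτ.2.1
          _ = eLpNorm (f τ) 2 volume * (δ n + eLpNorm φ 2 volume) := by rw [mul_add]
      calc ∫⁻ τ, ‖d n τ‖ₑ ∂μt ≤ ∫⁻ τ, eLpNorm (f τ) 2 volume * (δ n + eLpNorm φ 2 volume) ∂μt :=
            lintegral_mono_ae hle
        _ = (∫⁻ τ, eLpNorm (f τ) 2 volume ∂μt) * (δ n + eLpNorm φ 2 volume) :=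
            lintegral_mul_const'' _ hF2m
        _ < ⊤ := ENNReal.mul_lt_top hIf (ENNReal.add_lt_top.2
            ⟨ENNReal.ofReal_lt_top, hφ2.eLpNorm_lt_top⟩)
    -- convergence of the time integrals
    refine tendsto_of_enorm_sub_le (e := fun n => (∫⁻ τ, eLpNorm (f τ) 2 volume ∂μt) * δ n)
      (fun n => ?_) ?_
    · rw [← integral_sub (hdi n) hdφi]
      refine (enorm_integral_le_lintegral_enorm _).trans ?_
      calc ∫⁻ τ, ‖d n τ - dφ τ‖ₑ ∂μt ≤ ∫⁻ τ, eLpNorm (f τ) 2 volume * δ n ∂μt :=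
            lintegral_mono_ae (hgood.mono fun τ hτ => hτ.1 n)
        _ = (∫⁻ τ, eLpNorm (f τ) 2 volume ∂μt) * δ n := lintegral_mul_const'' _ hF2m
    · have h := ENNReal.Tendsto.const_mul hδ0 (Or.inr hIf.ne)
      rwa [mul_zero] at h
  -- ### conclusion
  have hsum : Tendsto (fun n => (∫ x, ⟪u₀ x, heatTest ν (Φ n) t x⟫) + (∫ τ in Ioo 0 t, c n τ) +
      ∫ τ in Ioo 0 t, d n τ) atTop (𝓝 (∫ x, ⟪u t x, φ x⟫)) := hlimL.congr hI
  have := tendsto_nhds_unique hsum ((hlimA.add hlimC).add hlimD)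
  rw [this, ← integral_Ioc_eq_integral_Ioo, ← integral_Ioc_eq_integral_Ioo]


end MainForced

end Literature.Analysis.FluidPDE

end
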